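import Literature.Geometry.Riemannian.MetricFlowKernelSubconvergenceAux
import Literature.Geometry.Riemannian.WassersteinW1OfWeakConvergence
import Literature.Geometry.Riemannian.WassersteinW1LimitPoints
import HarnessLib

/-!
# Subconvergence of pushed conjugate heat kernels at converging base points (Bamler 2023, §7.3,
# Claim in the proof of the Lemma on subconvergence over finitely many times; arXiv v1 Claim 162)

R. Bamler, *Compactness theory of the space of super Ricci flows*, Invent. Math. 233 (2023), §7.3.
In the proof of the Lemma (arXiv v1 Lemma 161: a sequence of metric flow pairs in
`𝔽_I(H, V, b, r)` subconverges within a correspondence over a finite set of times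
`t_1 < … < t_N`), once the time-slices `(𝒳ⁱ_{t_k}, d, μⁱ_{t_k})` are embedded isometrically,
`φⁱ_{t_k} : 𝒳ⁱ_{t_k} → Z_{t_k}`, into complete separable spaces with
`(φⁱ_{t_k})_* μⁱ_{t_k} → (φ^∞_{t_k})_* μ^∞_{t_k}` in `W₁`, one has the Claim (arXiv v1 Claim 162):
*"Let `1 ≤ l ≤ k ≤ N` and `x^∞ ∈ X^∞_{t_k}`. Then, after passing to a subsequence, there is a
probability measure `ν^∞_{x^∞;t_l} ∈ 𝒫(X^∞_{t_l})` such that for any sequence `xⁱ ∈ 𝒳ⁱ_{t_k}`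
with `φⁱ_{t_k}(xⁱ) → φ^∞_{t_k}(x^∞)` we have
`(φⁱ_{t_l})_* νⁱ_{xⁱ;t_l} → (φ^∞_{t_l})_* ν^∞_{x^∞;t_l}` in `W₁`."*

We prove it (`exists_subseq_tendsto_map_kernel`) for ONE approximating sequence `xⁱ`, in abstract
form: all metric-flow data are passed explicitly — Polish comparison spaces `Z_k, Z_l`, slices
`X_k i, X_l i` with isometric embeddings `φk i, φl i`, the conjugate heat kernels `νⁱ_{·;t_l}` on
`𝒳ⁱ_{t_k}` as probability kernels `κ i` having the gradient property at `T = 0` (Bamler 2023,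
Definition 3.2 (6) with `L = (t_k − t_l)^{-1/2}`) and uniformly bounded variances, the measures
`μⁱ_{t_k}, μⁱ_{t_l}` linked by the conjugate heat flow `μⁱ_{t_l} = ∫ νⁱ_{x;t_l} dμⁱ_{t_k}(x)`, their
`W₁`-limits `m_k, m_l` (so that `X^∞_{t_l} = supp m_l`), and `x ∈ supp m_k` with `φk i (xⁱ) → x`.
Conclusion: a subsequence of `(φl i)_* κ i (xⁱ)` `W₁`-converges to a probability measure `ν` on
`Z_l` with `supp ν ⊆ supp m_l`.

The proof is the printed one. *Tightness* (Lemma 2.4 (e),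
`isTightMeasureSet_range_of_forall_eventually_thickening`): for `0 < ε < 1` choose a compact
`K_ε ⊆ supp m_l` with `m_l(Z_l ∖ K_ε) < a` (inner regularity), so that
`μⁱ_{t_l}(𝒳 ∖ φ⁻¹(B(K_ε, ε))) < a` for large `i` (portmanteau for the closed set `Z_l ∖ B(K_ε, ε)`);
`μⁱ_{t_k}(B(xⁱ, 1)) ≥ p > 0` for large `i` (`x ∈ supp m_k`); if `νⁱ_{xⁱ;t_l}(𝒳 ∖ φ⁻¹(B(K_ε, ε))) > ε`
the gradient property would give `μⁱ_{t_l}(𝒳 ∖ φ⁻¹(B(K_ε, ε))) ≥ min(ε, Φ(Φ⁻¹(ε) − L) p) =: a`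
(`measure_le_of_gradient_property`), a contradiction. *Moments*: the variance bound and tightness
bound `∫ d(z₀, ·)² d(φl i)_* κ i(xⁱ)` uniformly (`lintegral_edist_sq_le_of_variance_le`), so
`exists_subseq_tendsto_wassersteinW1_of_isTightMeasureSet` (Lemma 2.4 (d) and the `W₁`-upgrade of
§2.2) yields the subsequence. *Support*: *"Since we had `K_ε ⊂ supp (φ^∞_{t_l})_* μ^∞_{t_l}` …,
we also get `supp ν' ⊂ supp (φ^∞_{t_l})_* μ^∞_{t_l}`"* — a ball `B(z, r)` off `supp m_l` has
`B(z, r/2) ⊆ Z_l ∖ B(K_ε, ε)` for `ε ≤ r/2`, so `ν(B(z, r/2)) ≤ liminf ≤ ε` for all small `ε`.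

## References

* R. H. Bamler, *Compactness theory of the space of super Ricci flows*, Invent. Math. 233 (2023),
  1121–1277 (arXiv:2008.09298), §7.3, Claim (arXiv v1 Claim 162) in the proof of the Lemma
  (arXiv v1 Lemma 161); §2.1, Lemma 2.4 (d), (e); §3.1, Definition 3.2 (6). [Bamler2023]
-/

noncomputable section

open Set MeasureTheory Filter TopologicalSpace Function Metric
open scoped Topology ENNReal NNReal

namespace Literature.Geometry.Riemannian

universe u

/-- **Bamler 2023, §7.3, Claim (arXiv v1 Claim 162)** (*"after passing to a subsequence, there is
a probability measure `ν^∞_{x^∞;t_l} ∈ 𝒫(X^∞_{t_l})` such that …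
`(φⁱ_{t_l})_* νⁱ_{xⁱ;t_l} → (φ^∞_{t_l})_* ν^∞_{x^∞;t_l}` in `W₁`"*), abstract form for one
approximating sequence: given isometric embeddings `φk n : Xk n → Zk`, `φl n : Xl n → Zl` into
Polish spaces, probability kernels `κ n` from `Xk n` to `Xl n` with the gradient property at
`T = 0` (constant `L`) and `Var(κ n x) ≤ W`, probability measures `μk n`, `μl n` with
`μl n = ∫ κ n x d(μk n)(x)`, `W₁`-limits `mk` of `(φk n)_* μk n` and `ml` of `(φl n)_* μl n`, and
`x ∈ supp mk` with `φk n (xn n) → x`: **some subsequence of `(φl n)_* κ n (xn n)` `W₁`-converges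
to a probability measure `ν` on `Zl` with `supp ν ⊆ supp ml`.**
[cite: Bamler2023, §7.3, Claim (arXiv v1 Claim 162) in the proof of the Lemma (arXiv v1 Lemma 161)] -/
theorem exists_subseq_tendsto_map_kernel
    {Zk Zl : Type u} [MetricSpace Zk] [MeasurableSpace Zk] [BorelSpace Zk]
    [SecondCountableTopology Zk] [CompleteSpace Zk]
    [MetricSpace Zl] [MeasurableSpace Zl] [BorelSpace Zl] [SecondCountableTopology Zl]
    [CompleteSpace Zl]
    {Xk Xl : ℕ → Type u} [∀ n, MetricSpace (Xk n)] [∀ n, MeasurableSpace (Xk n)]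
    [∀ n, BorelSpace (Xk n)] [∀ n, SecondCountableTopology (Xk n)]
    [∀ n, MetricSpace (Xl n)] [∀ n, MeasurableSpace (Xl n)] [∀ n, BorelSpace (Xl n)]
    [∀ n, SecondCountableTopology (Xl n)] [∀ n, CompleteSpace (Xl n)]
    (φk : ∀ n, Xk n → Zk) (φl : ∀ n, Xl n → Zl) (hφk : ∀ n, Isometry (φk n))
    (hφl : ∀ n, Isometry (φl n))
    -- `ν^n_{·;t_l}` on `𝒳^n_{t_k}` (`t_l < t_k`): probability kernels with the gradient property at
    -- `T = 0` (constant `L = (t_k − t_l)^{-1/2}`) and uniformly bounded variances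
    (κ : ∀ n, Xk n → Measure (Xl n)) [∀ n x, IsProbabilityMeasure (κ n x)] {L : ℝ≥0} {W : ℝ}
    (hgrad : ∀ n (v : Xl n → ℝ), Measurable v → (∀ y, v y ∈ Icc (0 : ℝ) 1) →
      (∃ c, ∀ x, ∫ y, v y ∂κ n x = c) ∨
        ∃ f : Xk n → ℝ, LipschitzWith L f ∧ ∀ x, ∫ y, v y ∂κ n x = MetricFlow.Phi (f x))
    (hvar : ∀ n x, variance (κ n x) (κ n x) ≤ ENNReal.ofReal W)
    -- `μ^n_{t_k}`, `μ^n_{t_l} = ∫ ν^n_{x;t_l} dμ^n_{t_k}(x)` and their `W₁`-limits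
    (μk : ∀ n, Measure (Xk n)) (μl : ∀ n, Measure (Xl n)) [∀ n, IsProbabilityMeasure (μk n)]
    [∀ n, IsProbabilityMeasure (μl n)]
    (hchf : ∀ n (f : Xl n → ℝ≥0∞), Measurable f → ∫⁻ y, f y ∂μl n = ∫⁻ x, ∫⁻ y, f y ∂κ n x ∂μk n)
    (mk : Measure Zk) (ml : Measure Zl) [IsProbabilityMeasure mk] [IsProbabilityMeasure ml]
    (hmk : Tendsto (fun n ↦ wassersteinW1 ((μk n).map (φk n)) mk) atTop (𝓝 0))
    (hml : Tendsto (fun n ↦ wassersteinW1 ((μl n).map (φl n)) ml) atTop (𝓝 0))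
    {x : Zk} (hx : x ∈ mk.support) (xn : ∀ n, Xk n)
    (hxn : Tendsto (fun n ↦ φk n (xn n)) atTop (𝓝 x)) :
    ∃ ψ : ℕ → ℕ, StrictMono ψ ∧ ∃ ν : Measure Zl, IsProbabilityMeasure ν ∧
      ν.support ⊆ ml.support ∧
      Tendsto (fun n ↦ wassersteinW1 ((κ (ψ n) (xn (ψ n))).map (φl (ψ n))) ν) atTop (𝓝 0) := by
  have hφlm : ∀ n, Measurable (φl n) := fun n ↦ (hφl n).continuous.measurable
  haveI hαP : ∀ n, IsProbabilityMeasure ((κ n (xn n)).map (φl n)) := fun n ↦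
    Measure.isProbabilityMeasure_map (hφlm n).aemeasurable
  haveI : ∀ n, IsProbabilityMeasure ((μl n).map (φl n)) := fun n ↦
    Measure.isProbabilityMeasure_map (hφlm n).aemeasurable
  /- mass near the base points: `μk n (B(xn n, 1)) ≥ p > 0` for large `n` (`x ∈ supp mk`,
  *"we can find a `D < ∞` such that for large `i`, `μⁱ_{t_k}(B(xⁱ, D)) ≥ ½`"*) -/
  obtain ⟨p, hp0, hpev⟩ : ∃ p : ℝ≥0∞, 0 < p ∧ ∀ᶠ n in atTop, p ≤ μk n (ball (xn n) 1) := by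
    have h := liminf_measure_ball_pos_of_tendsto_wassersteinW1_map φk hφk μk hmk hx hxn one_pos
    have h1 : liminf (fun n ↦ μk n (ball (xn n) 1)) atTop ≤ 1 :=
      liminf_le_of_frequently_le' (Frequently.of_forall fun n ↦ prob_le_one)
    exact ⟨_, ENNReal.half_pos h.ne', (eventually_lt_of_lt_liminf
      (ENNReal.half_lt_self h.ne' (ne_top_of_le_ne_top ENNReal.one_ne_top h1))).mono
      fun n hn ↦ hn.le⟩
  /- one scale `ε`: a compact `K_ε ⊆ supp ml` with `((φl n)_* κ n (xn n))(Zl ∖ B(K_ε, ε)) ≤ ε`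
  for large `n` -/
  have hscale : ∀ ε : ℝ, 0 < ε → ε < 1 → ∃ K : Set Zl, IsCompact K ∧ K ⊆ ml.support ∧
      ∀ᶠ n in atTop, (κ n (xn n)).map (φl n) (thickening ε K)ᶜ ≤ ENNReal.ofReal ε := by
    intro ε hε0 hε1
    -- the threshold `a = min(ε, Φ(Φ⁻¹(ε) − L) p)` (*"for small enough `α`"*)
    obtain ⟨a, ha0, hatop, haε, hap⟩ : ∃ a : ℝ≥0∞, a ≠ 0 ∧ a ≠ ∞ ∧ a ≤ ENNReal.ofReal ε ∧
        a ≤ ENNReal.ofReal (MetricFlow.Phi (MetricFlow.PhiInv ε - L * 1)) * p :=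
      ⟨min (ENNReal.ofReal ε) (ENNReal.ofReal (MetricFlow.Phi (MetricFlow.PhiInv ε - L * 1)) * p),
        (lt_min (ENNReal.ofReal_pos.2 hε0) (ENNReal.mul_pos
          (ENNReal.ofReal_pos.2 (MetricFlow.Phi_pos _)).ne' hp0.ne')).ne',
        ne_top_of_le_ne_top ENNReal.ofReal_ne_top (min_le_left _ _), min_le_left _ _,
        min_le_right _ _⟩
    -- a compact `K ⊆ supp ml` carrying all but `< a` of the mass of `ml` (inner regularity)
    obtain ⟨K, hK, hKsupp, hKa⟩ : ∃ K : Set Zl, IsCompact K ∧ K ⊆ ml.support ∧ ml Kᶜ < a := by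
      obtain ⟨K₀, hK₀, h₀⟩ := isTightMeasureSet_iff_exists_isCompact_measure_compl_le.1
        (isTightMeasureSet_singleton (μ := ml)) (a / 2) (ENNReal.half_pos ha0)
      refine ⟨K₀ ∩ ml.support, hK₀.inter_right Measure.isClosed_support, inter_subset_right, ?_⟩
      calc ml (K₀ ∩ ml.support)ᶜ ≤ ml K₀ᶜ + ml ml.supportᶜ := by
            rw [compl_inter]
            exact measure_union_le _ _
        _ = ml K₀ᶜ := by rw [Measure.measure_compl_support, add_zero]
        _ ≤ a / 2 := h₀ _ rfl
        _ < a := ENNReal.half_lt_self ha0 hatop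
    refine ⟨K, hK, hKsupp, ?_⟩
    have hF : IsClosed (thickening ε K)ᶜ := isOpen_thickening.isClosed_compl
    -- `((φl n)_* μl n)(Zl ∖ B(K, ε)) < a` for large `n` (portmanteau for the closed set)
    have hev : ∀ᶠ n in atTop, (μl n).map (φl n) (thickening ε K)ᶜ < a :=
      eventually_lt_of_limsup_lt
        ((limsup_measure_le_of_isClosed_of_tendsto_wassersteinW1 hml hF).trans_lt
          ((measure_mono (compl_subset_compl.2 (self_subset_thickening hε0 K))).trans_lt hKa))
    filter_upwards [hev, hpev] with n hn hpn
    rw [Measure.map_apply (hφlm n) hF.measurableSet] at hn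
    rw [Measure.map_apply (hφlm n) hF.measurableSet]
    -- otherwise the gradient property spreads the mass: `μl n (φ⁻¹(Zl ∖ B(K, ε))) ≥ a`
    by_contra hcon
    exact (not_le.2 hn) ((le_min haε hap).trans (measure_le_of_gradient_property (κ n) (hgrad n)
      (μk n) (μl n) (hchf n) (hF.measurableSet.preimage (hφlm n)) hε0 hε1 hpn (not_le.1 hcon)))
  /- tightness (Lemma 2.4 (e)) -/
  have htight : IsTightMeasureSet (range fun n ↦ (κ n (xn n)).map (φl n)) := by
    refine isTightMeasureSet_range_of_forall_eventually_thickening fun η hη ↦ ?_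
    have hε0 : 0 < min (η : ℝ) 2⁻¹ := lt_min (by exact_mod_cast hη) (by norm_num)
    obtain ⟨K, hK, -, hev⟩ := hscale _ hε0 ((min_le_right _ _).trans_lt (by norm_num))
    refine ⟨K, hK, hev.mono fun n hn ↦ ?_⟩
    calc (κ n (xn n)).map (φl n) (thickening (η : ℝ) K)ᶜ
        ≤ (κ n (xn n)).map (φl n) (thickening (min (η : ℝ) 2⁻¹) K)ᶜ :=
          measure_mono (compl_subset_compl.2 (thickening_mono (min_le_left _ _) K))
      _ ≤ ENNReal.ofReal (min (η : ℝ) 2⁻¹) := hn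
      _ ≤ ENNReal.ofReal η := ENNReal.ofReal_le_ofReal (min_le_left _ _)
      _ = η := ENNReal.ofReal_coe_nnreal
  /- uniform second moments: `Var((φl n)_* κ n (xn n)) ≤ W` and mass `≥ ½` on a fixed compact -/
  obtain ⟨z₀⟩ : Nonempty Zl := nonempty_of_isProbabilityMeasure ml
  obtain ⟨V, hV⟩ : ∃ V : ℝ, ∀ n,
      ∫⁻ z, edist z₀ z ^ 2 ∂(κ n (xn n)).map (φl n) ≤ ENNReal.ofReal V := by
    obtain ⟨K, hK, hKle⟩ :=
      isTightMeasureSet_iff_exists_isCompact_measure_compl_le.1 htight 2⁻¹ (by simp)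
    obtain ⟨R, hR⟩ := hK.isBounded.subset_closedBall z₀
    refine ⟨4 * R ^ 2 + 4 * max W 0, fun n ↦ lintegral_edist_sq_le_of_variance_le _
      (le_max_right _ _) (((variance_map_le (hφl n) _).trans (hvar n (xn n))).trans
        (ENNReal.ofReal_le_ofReal (le_max_left _ _))) hK.isClosed.measurableSet ?_ z₀
      fun y hy ↦ mem_closedBall.1 (hR hy)⟩
    -- `½ ≤ α n K` from `α n Kᶜ ≤ ½`
    have h := hKle _ (mem_range_self n)
    rw [prob_compl_eq_one_sub hK.isClosed.measurableSet, tsub_le_iff_right,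
      ← ENNReal.inv_two_add_inv_two] at h
    exact (ENNReal.add_le_add_iff_left (by simp)).1 h
  /- the subsequence (Lemma 2.4 (d) and the `W₁`-upgrade) -/
  obtain ⟨ψ, hψ, ν, hν, -, hconv⟩ :=
    exists_subseq_tendsto_wassersteinW1_of_isTightMeasureSet htight z₀ hV
  refine ⟨ψ, hψ, ν, hν, fun z hz ↦ ?_, hconv⟩
  /- support: `supp ν ⊆ supp ml` -/
  by_contra hzs
  obtain ⟨r, hr, hball⟩ := Metric.isOpen_iff.1 Measure.isOpen_compl_support z hzs
  haveI : ∀ n, IsProbabilityMeasure ((κ (ψ n) (xn (ψ n))).map (φl (ψ n))) := fun n ↦ hαP (ψ n)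
  have hsmall : ∀ ε : ℝ, 0 < ε → ε ≤ r / 2 → ε < 1 → ν (ball z (r / 2)) ≤ ENNReal.ofReal ε := by
    intro ε hε0 hεr hε1
    obtain ⟨K, -, hKsupp, hev⟩ := hscale ε hε0 hε1
    -- `B(z, r/2)` misses `B(K, ε)` since `K ⊆ supp ml` and `B(z, r) ∩ supp ml = ∅`
    have hsub : ball z (r / 2) ⊆ (thickening ε K)ᶜ := fun w hw hwK ↦ by
      obtain ⟨y, hy, hwy⟩ := mem_thickening_iff.1 hwK
      refine hball ?_ (hKsupp hy)
      rw [mem_ball] at hw ⊢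
      calc dist y z ≤ dist w y + dist w z := dist_triangle_left _ _ _
        _ < ε + r / 2 := add_lt_add hwy hw
        _ ≤ r := by linarith
    calc ν (ball z (r / 2))
        ≤ liminf (fun n ↦ (κ (ψ n) (xn (ψ n))).map (φl (ψ n)) (ball z (r / 2))) atTop :=
          measure_ball_le_liminf_of_tendsto_wassersteinW1 hconv z (r / 2)
      _ ≤ liminf (fun n ↦ (κ (ψ n) (xn (ψ n))).map (φl (ψ n)) (thickening ε K)ᶜ) atTop :=
          liminf_le_liminf (Eventually.of_forall fun n ↦ measure_mono hsub)
      _ ≤ ENNReal.ofReal ε :=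
          liminf_le_of_frequently_le' (hψ.tendsto_atTop.eventually hev).frequently
  have hzero : ν (ball z (r / 2)) = 0 := by
    refine le_antisymm (ENNReal.le_of_forall_pos_le_add fun η hη _ ↦ ?_) zero_le
    have hε0 : 0 < min (η : ℝ) (min (r / 2) 2⁻¹) :=
      lt_min (by exact_mod_cast hη) (lt_min (half_pos hr) (by norm_num))
    calc ν (ball z (r / 2)) ≤ ENNReal.ofReal (min (η : ℝ) (min (r / 2) 2⁻¹)) :=
          hsmall _ hε0 ((min_le_right _ _).trans (min_le_left _ _))
            (((min_le_right _ _).trans (min_le_right _ _)).trans_lt (by norm_num))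
      _ ≤ ENNReal.ofReal η := ENNReal.ofReal_le_ofReal (min_le_left _ _)
      _ = 0 + η := by rw [ENNReal.ofReal_coe_nnreal, zero_add]
  exact ((Measure.mem_support_iff_forall z).1 hz _ (ball_mem_nhds z (half_pos hr))).ne' hzero

end Literature.Geometry.Riemannian

end
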